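import Literature.Analysis.FunctionSpaces.TorusTrigPoly
import Literature.Analysis.FunctionSpaces.TorusInverseLaplacianCalculus
import HarnessLib

/-!
# FunctionalMining — an exact, COMPUTABLE trigonometric-polynomial calculus on `T³` (engine, part 1)

Search for candidate a priori estimates; no regularity claim. Cell `pub-nsfunc`, prove seat
(gen 18). TOOL FILE (no statement about Navier–Stokes).

The cell's kernel witnesses (three-wave field, crossed shears, spiral jets, planar fields) are real
trigonometric polynomials on the unit torus `T³ = (ℝ/ℤ)³`; every quantity the K0 rows evaluate on
them (strain entries, `|S|²`, the pressure `π = Δ⁻¹(−tr(∇v)²)`, its Hessian, production integrals)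
is again a trigonometric polynomial, and every row integral is the zero Fourier mode of a finite
product. This file makes that bookkeeping COMPUTABLE, so that the kernel evaluates witnesses by
`decide` instead of hand-unrolled coefficient tables:

* `GQ` — Gaussian rationals `a + b i`, `a b : ℚ` (computable ring operations, cast `GQ.toC : GQ → ℂ`);
* `TP := List (Mode × GQ)`, `Mode := ℤ × ℤ × ℤ` — a finite Fourier table; its meaning
  `TP.eval p x = ∑_{(k,c) ∈ p} c · e_k(x)` (`e_k = UnitAddTorus.mFourier k`), real part `TP.evalR`;
* computable operations with SOUNDNESS lemmas: `++` (sum, `eval_append`), `TP.neg`, `TP.smul`,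
  `TP.mul` (convolution; `eval_mul : eval (p.mul q) = eval p * eval q`), `TP.collect` (collect like
  terms; `eval_collect`), `TP.sum3` (coordinate sums), and smoothness `isSmooth_eval`; `TP.IsReal`
  (real-valued tables) with `evalR_mul` and closure lemmas.

Part 2 (`TrigPolyExactCalculus`) adds `∂ⱼ`, `Δ`, `Δ⁻¹`, `∫` (`TP.D`, `TP.lapT`, `TP.linv`,
`TP.coeff0`) with their soundness lemmas. Only algebra and calculus of finite Fourier sums; the
engine carries no analysis beyond the tree's `TorusTrigPoly` / `TorusInverseLaplacianCalculus`.
-/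

noncomputable section

open MeasureTheory Complex UnitAddTorus

namespace Summit.NavierStokesRegularity.FunctionalMining

open Literature.Analysis.FunctionSpaces Literature.Analysis.FunctionSpaces.Torus

namespace TrigPolyExact

/-! ## 1. Gaussian rationals -/

/-- A Gaussian rational `re + im·i` with `re im : ℚ` (computable coefficients). [ours; bookkeeping] -/
structure GQ where
  /-- real part -/
  re : ℚ
  /-- imaginary part -/
  im : ℚ
deriving DecidableEq, Repr

namespace GQ

/-- `0`. [ours; bookkeeping] -/
protected def zero : GQ := ⟨0, 0⟩
/-- `i`. [ours; bookkeeping] -/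
protected def I : GQ := ⟨0, 1⟩
/-- Sum. [ours; bookkeeping] -/
protected def add (a b : GQ) : GQ := ⟨a.re + b.re, a.im + b.im⟩
/-- Product. [ours; bookkeeping] -/
protected def mul (a b : GQ) : GQ := ⟨a.re * b.re - a.im * b.im, a.re * b.im + a.im * b.re⟩
/-- Negation. [ours; bookkeeping] -/
protected def neg (a : GQ) : GQ := ⟨-a.re, -a.im⟩
/-- Rational multiple. [ours; bookkeeping] -/
protected def smul (q : ℚ) (a : GQ) : GQ := ⟨q * a.re, q * a.im⟩

/-- The complex number `re + im·i`. [ours; bookkeeping] -/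
def toC (a : GQ) : ℂ := (a.re : ℂ) + (a.im : ℂ) * Complex.I

/-- Unfolding `toC`. [ours; bookkeeping] -/
@[simp] theorem toC_mk (a b : ℚ) : toC ⟨a, b⟩ = (a : ℂ) + (b : ℂ) * Complex.I := rfl

/-- `toC 0 = 0`. [ours; bookkeeping] -/
@[simp] theorem toC_zero : GQ.zero.toC = 0 := by simp [GQ.zero, toC]

/-- `toC i = i`. [ours; bookkeeping] -/
@[simp] theorem toC_I : GQ.I.toC = Complex.I := by simp [GQ.I, toC]

/-- `toC` is additive. [ours; bookkeeping] -/
@[simp] theorem toC_add (a b : GQ) : (a.add b).toC = a.toC + b.toC := by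
  simp only [GQ.add, toC]; push_cast; ring

/-- `toC` is multiplicative. [ours; bookkeeping] -/
@[simp] theorem toC_mul (a b : GQ) : (a.mul b).toC = a.toC * b.toC := by
  apply Complex.ext
  · simp [GQ.mul, toC]
  · simp [GQ.mul, toC]

/-- `toC` commutes with negation. [ours; bookkeeping] -/
@[simp] theorem toC_neg (a : GQ) : a.neg.toC = -a.toC := by
  simp only [GQ.neg, toC]; push_cast; ring

/-- `toC` commutes with rational multiples. [ours; bookkeeping] -/
@[simp] theorem toC_smul (q : ℚ) (a : GQ) : (GQ.smul q a).toC = (q : ℂ) * a.toC := by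
  simp only [GQ.smul, toC]; push_cast; ring

/-- Real part of `toC`. [ours; bookkeeping] -/
@[simp] theorem toC_re (a : GQ) : a.toC.re = a.re := by simp [toC]

/-- Imaginary part of `toC`. [ours; bookkeeping] -/
@[simp] theorem toC_im (a : GQ) : a.toC.im = a.im := by simp [toC]

end GQ

/-! ## 2. Modes and Fourier tables -/

/-- A wave vector `(k₀, k₁, k₂) ∈ ℤ³`. [ours; bookkeeping] -/
abbrev Mode := ℤ × ℤ × ℤ

/-- The wave vector as a function `Fin 3 → ℤ` (Mathlib's index type for `mFourier`). [ours; bookkeeping] -/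
def Mode.vec (k : Mode) : Fin 3 → ℤ := ![k.1, k.2.1, k.2.2]

/-- Component `0` of `vec`. [ours; bookkeeping] -/
@[simp] theorem Mode.vec_zero_apply (k : Mode) : k.vec 0 = k.1 := rfl
/-- Component `1` of `vec`. [ours; bookkeeping] -/
@[simp] theorem Mode.vec_one_apply (k : Mode) : k.vec 1 = k.2.1 := rfl
/-- Component `2` of `vec`. [ours; bookkeeping] -/
@[simp] theorem Mode.vec_two_apply (k : Mode) : k.vec 2 = k.2.2 := rfl

/-- `vec` is additive. [ours; bookkeeping] -/
theorem Mode.vec_add (k l : Mode) : (k + l).vec = k.vec + l.vec := by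
  ext i; fin_cases i <;> rfl

/-- `vec k = 0 ↔ k = 0`. [ours; bookkeeping] -/
theorem Mode.vec_eq_zero_iff (k : Mode) : k.vec = 0 ↔ k = 0 := by
  obtain ⟨a, b, c⟩ := k
  constructor
  · intro h
    have h0 := congrFun h 0; have h1 := congrFun h 1; have h2 := congrFun h 2
    simp only [Mode.vec, Matrix.cons_val_zero, Matrix.cons_val_one, Matrix.cons_val,
      Pi.zero_apply] at h0 h1 h2
    simp [h0, h1, h2]
  · rintro h
    simp only [Prod.mk_eq_zero] at h
    obtain ⟨rfl, rfl, rfl⟩ := h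
    ext i; fin_cases i <;> rfl

/-- `|k|² = k₀² + k₁² + k₂²`. [ours; bookkeeping] -/
def Mode.normSq (k : Mode) : ℚ := (k.1 : ℚ) ^ 2 + (k.2.1 : ℚ) ^ 2 + (k.2.2 : ℚ) ^ 2

/-- A finite Fourier table: a list of (mode, Gaussian-rational coefficient). [ours; bookkeeping] -/
abbrev TP := List (Mode × GQ)

namespace TP

/-- The trigonometric polynomial a table denotes: `eval p x = ∑_{(k,c) ∈ p} c · e_k(x)`. [ours; bookkeeping] -/
def eval (p : TP) (x : UnitAddTorus (Fin 3)) : ℂ :=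
  (p.map fun t => t.2.toC * mFourier t.1.vec x).sum

/-- Its real part. [ours; bookkeeping] -/
def evalR (p : TP) (x : UnitAddTorus (Fin 3)) : ℝ := (eval p x).re

/-- The empty table denotes `0`. [ours; bookkeeping] -/
@[simp] theorem eval_nil (x : UnitAddTorus (Fin 3)) : eval [] x = 0 := rfl

/-- `eval` of a table with a first term split off. [ours; bookkeeping] -/
@[simp] theorem eval_cons (t : Mode × GQ) (p : TP) (x : UnitAddTorus (Fin 3)) :
    eval (t :: p) x = t.2.toC * mFourier t.1.vec x + eval p x := by
  simp [eval]

/-- `eval` is additive under concatenation. [ours; bookkeeping] -/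
@[simp] theorem eval_append (p q : TP) (x : UnitAddTorus (Fin 3)) :
    eval (p ++ q) x = eval p x + eval q x := by
  simp [eval, List.map_append, List.sum_append]

/-- Negation of a table. [ours; bookkeeping] -/
def neg (p : TP) : TP := p.map fun t => (t.1, t.2.neg)

/-- `eval (neg p) = −eval p`. [ours; bookkeeping] -/
@[simp] theorem eval_neg (p : TP) (x : UnitAddTorus (Fin 3)) : eval (neg p) x = -eval p x := by
  induction p with
  | nil => simp [neg]
  | cons t p ih =>
    simp only [neg, List.map_cons, eval_cons] at ih ⊢
    rw [ih, GQ.toC_neg]; ring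

/-- Rational multiple of a table. [ours; bookkeeping] -/
def smul (q : ℚ) (p : TP) : TP := p.map fun t => (t.1, GQ.smul q t.2)

/-- `eval (smul q p) = q · eval p`. [ours; bookkeeping] -/
@[simp] theorem eval_smul (q : ℚ) (p : TP) (x : UnitAddTorus (Fin 3)) :
    eval (smul q p) x = (q : ℂ) * eval p x := by
  induction p with
  | nil => simp [smul]
  | cons t p ih =>
    simp only [smul, List.map_cons, eval_cons] at ih ⊢
    rw [ih, GQ.toC_smul]; ring

/-- Product of one term with a table. [ours; bookkeeping] -/
def mulTerm (s : Mode × GQ) (q : TP) : TP := q.map fun t => (s.1 + t.1, s.2.mul t.2)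

/-- `eval (mulTerm s q) = (c_s e_{k_s}) · eval q`. [ours; bookkeeping] -/
theorem eval_mulTerm (s : Mode × GQ) (q : TP) (x : UnitAddTorus (Fin 3)) :
    eval (mulTerm s q) x = s.2.toC * mFourier s.1.vec x * eval q x := by
  induction q with
  | nil => simp [mulTerm]
  | cons t q ih =>
    simp only [mulTerm, List.map_cons, eval_cons] at ih ⊢
    rw [ih, GQ.toC_mul, Mode.vec_add, mFourier_add]; ring

/-- Product of tables (convolution of coefficients). [ours; bookkeeping] -/
def mul (p q : TP) : TP := p.flatMap fun s => mulTerm s q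

/-- **Soundness of the product**: `eval (mul p q) = eval p · eval q`. [ours; bookkeeping] -/
@[simp] theorem eval_mul (p q : TP) (x : UnitAddTorus (Fin 3)) :
    eval (mul p q) x = eval p x * eval q x := by
  induction p with
  | nil => simp [mul]
  | cons s p ih =>
    simp only [mul, List.flatMap_cons, eval_append, eval_cons] at ih ⊢
    rw [ih, eval_mulTerm]; ring

/-- Sum of a list of tables. [ours; bookkeeping] -/
def sum (l : List TP) : TP := l.foldr (· ++ ·) []

/-- `eval (sum l) = ∑ eval`. [ours; bookkeeping] -/
@[simp] theorem eval_sum (l : List TP) (x : UnitAddTorus (Fin 3)) :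
    eval (sum l) x = (l.map fun p => eval p x).sum := by
  induction l with
  | nil => rfl
  | cons p l ih => simp only [sum, List.foldr_cons, eval_append, List.map_cons, List.sum_cons] at ih ⊢; rw [ih]

/-- Sum of three tables indexed by `Fin 3` (the shape of every `∑ᵢ` over coordinates). [ours; bookkeeping] -/
def sum3 (f : Fin 3 → TP) : TP := f 0 ++ (f 1 ++ f 2)

/-- `eval (sum3 f) = eval (f 0) + eval (f 1) + eval (f 2)`. [ours; bookkeeping] -/
@[simp] theorem eval_sum3 (f : Fin 3 → TP) (x : UnitAddTorus (Fin 3)) :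
    eval (sum3 f) x = eval (f 0) x + eval (f 1) x + eval (f 2) x := by
  simp [sum3, add_assoc]

/-! ### Collecting like terms (efficiency only; sound for `eval`) -/

/-- Insert a term, adding its coefficient to an existing entry with the same mode. [ours; bookkeeping] -/
def insertT (t : Mode × GQ) : TP → TP
  | [] => [t]
  | s :: rest => if s.1 = t.1 then (s.1, s.2.add t.2) :: rest else s :: insertT t rest

/-- `eval (insertT t p) = c_t e_{k_t} + eval p`. [ours; bookkeeping] -/
theorem eval_insertT (t : Mode × GQ) (p : TP) (x : UnitAddTorus (Fin 3)) :
    eval (insertT t p) x = t.2.toC * mFourier t.1.vec x + eval p x := by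
  induction p with
  | nil => simp [insertT]
  | cons s p ih =>
    by_cases h : s.1 = t.1
    · simp only [insertT, h, if_true, eval_cons, GQ.toC_add]; ring
    · simp only [insertT, h, if_false, eval_cons, ih]; ring

/-- Collect like terms and drop zero coefficients. [ours; bookkeeping] -/
def collect (p : TP) : TP := (p.foldr insertT []).filter fun t => t.2 ≠ GQ.zero

/-- Dropping zero coefficients does not change `eval`. [ours; bookkeeping] -/
theorem eval_filter_ne_zero (p : TP) (x : UnitAddTorus (Fin 3)) :
    eval (p.filter fun t => t.2 ≠ GQ.zero) x = eval p x := by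
  induction p with
  | nil => simp
  | cons s p ih =>
    by_cases h : s.2 = GQ.zero
    · rw [List.filter_cons_of_neg (by simp [h]), ih, eval_cons, h, GQ.toC_zero, zero_mul, zero_add]
    · rw [List.filter_cons_of_pos (by simp [h]), eval_cons, eval_cons, ih]

/-- **Soundness of `collect`**: `eval (collect p) = eval p`. [ours; bookkeeping] -/
@[simp] theorem eval_collect (p : TP) (x : UnitAddTorus (Fin 3)) : eval (collect p) x = eval p x := by
  unfold collect
  rw [eval_filter_ne_zero]
  induction p with
  | nil => rfl
  | cons s p ih => simp only [List.foldr_cons, eval_insertT, eval_cons, ih]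

/-- Product followed by collection (the operation used in computations). [ours; bookkeeping] -/
def mulC (p q : TP) : TP := collect (mul p q)

/-- Soundness of `mulC`. [ours; bookkeeping] -/
@[simp] theorem eval_mulC (p q : TP) (x : UnitAddTorus (Fin 3)) :
    eval (mulC p q) x = eval p x * eval q x := by
  simp [mulC]

/-! ### Smoothness -/

/-- Every table denotes a smooth function. [ours; bookkeeping] -/
theorem isSmooth_eval (p : TP) : IsSmooth (eval p) := by
  induction p with
  | nil => exact isSmooth_const (0 : ℂ)
  | cons t p ih =>
    have h1 : IsSmooth (fun x : UnitAddTorus (Fin 3) => t.2.toC * mFourier t.1.vec x) := by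
      have := isSmooth_mFourier_smul (d := Fin 3) t.1.vec t.2.toC
      simpa [smul_eq_mul, mul_comm] using this
    have : eval (t :: p) = fun x => t.2.toC * mFourier t.1.vec x + eval p x := by
      funext x; exact eval_cons t p x
    rw [this]
    exact h1.add ih

/-- Hence its real part is smooth. [ours; bookkeeping] -/
theorem isSmooth_evalR (p : TP) : IsSmooth (evalR p) :=
  IsSmooth.comp_clm Complex.reCLM (isSmooth_eval p)

/-- `evalR` of a concatenation. [ours; bookkeeping] -/
@[simp] theorem evalR_append (p q : TP) (x : UnitAddTorus (Fin 3)) :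
    evalR (p ++ q) x = evalR p x + evalR q x := by
  simp [evalR]

/-- `evalR` of a negation. [ours; bookkeeping] -/
@[simp] theorem evalR_neg (p : TP) (x : UnitAddTorus (Fin 3)) : evalR (neg p) x = -evalR p x := by
  simp [evalR]

/-- `evalR` of a rational multiple. [ours; bookkeeping] -/
@[simp] theorem evalR_smul (q : ℚ) (p : TP) (x : UnitAddTorus (Fin 3)) :
    evalR (smul q p) x = (q : ℝ) * evalR p x := by
  simp [evalR, Complex.mul_re]

/-- `evalR` is unchanged by `collect`. [ours; bookkeeping] -/
@[simp] theorem evalR_collect (p : TP) (x : UnitAddTorus (Fin 3)) : evalR (collect p) x = evalR p x := by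
  simp [evalR]

/-! ### Real tables: products of real parts -/

/-- A table is REAL if the function it denotes is real-valued. [ours; bookkeeping] -/
def IsReal (p : TP) : Prop := ∀ x, (eval p x).im = 0

/-- For real tables the real part is multiplicative. [ours; bookkeeping] -/
theorem evalR_mul {p q : TP} (hp : IsReal p) (hq : IsReal q) (x : UnitAddTorus (Fin 3)) :
    evalR (mul p q) x = evalR p x * evalR q x := by
  simp only [evalR, eval_mul, Complex.mul_re, hp x, hq x, mul_zero, sub_zero]

/-- For real tables `evalR` is multiplicative (`mulC`). [ours; bookkeeping] -/
@[simp] theorem evalR_mulC {p q : TP} (hp : IsReal p) (hq : IsReal q) (x : UnitAddTorus (Fin 3)) :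
    evalR (mulC p q) x = evalR p x * evalR q x := by
  rw [mulC, evalR_collect, evalR_mul hp hq]

/-- Reality is preserved by concatenation. [ours; bookkeeping] -/
theorem IsReal.append {p q : TP} (hp : IsReal p) (hq : IsReal q) : IsReal (p ++ q) := fun x => by
  simp [hp x, hq x]

/-- Reality is preserved by negation. [ours; bookkeeping] -/
theorem IsReal.neg {p : TP} (hp : IsReal p) : IsReal (neg p) := fun x => by simp [hp x]

/-- Reality is preserved by rational multiples. [ours; bookkeeping] -/
theorem IsReal.smul {p : TP} (hp : IsReal p) (q : ℚ) : IsReal (smul q p) := fun x => by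
  simp [Complex.mul_im, hp x]

/-- Reality is preserved by products. [ours; bookkeeping] -/
theorem IsReal.mul {p q : TP} (hp : IsReal p) (hq : IsReal q) : IsReal (mul p q) := fun x => by
  simp [Complex.mul_im, hp x, hq x]

/-- Reality is preserved by `collect`. [ours; bookkeeping] -/
theorem IsReal.collect {p : TP} (hp : IsReal p) : IsReal (collect p) := fun x => by
  simp [hp x]

/-- Reality is preserved by `sum3`. [ours; bookkeeping] -/
theorem IsReal.sum3 {f : Fin 3 → TP} (hf : ∀ i, IsReal (f i)) : IsReal (sum3 f) := fun x => by
  simp [hf 0 x, hf 1 x, hf 2 x]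

/-- Reality is preserved by `mulC`. [ours; bookkeeping] -/
theorem IsReal.mulC {p q : TP} (hp : IsReal p) (hq : IsReal q) : IsReal (mulC p q) :=
  (hp.mul hq).collect

/-- For a real table, `eval = evalR` as complex numbers. [ours; bookkeeping] -/
theorem IsReal.eval_eq {p : TP} (hp : IsReal p) (x : UnitAddTorus (Fin 3)) :
    eval p x = (evalR p x : ℂ) := by
  apply Complex.ext <;> simp [evalR, hp x]

end TP

end TrigPolyExact

end Summit.NavierStokesRegularity.FunctionalMining

end
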